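import Mathlib.MeasureTheory.Measure.Prod
import Mathlib.Analysis.SpecialFunctions.Pow.Real
import Summits.CriticalPhenomena.CardyFormulaZ2.Theses.CardyFlipRusso
import Literature.Probability.Percolation.VoronoiCrossing
import Literature.Analysis.FunctionSpaces.PoissonPointProcess
import HarnessLib

/-!
# Vocabulary of the line `Sketch` / card `voronoi-blocks-on-fixed-gs` for crux `SquareFromVoronoiHub`
# (stmt-CriticalPhenomena-6434, route `CardyFlipRusso`, sub-problem `CardyFormulaZ2`)

DEFINITIONS MODULE of the line (lead `prover-line-stmt-CriticalPhenomena-6434-0`, 2026-08-16): the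
objects that the line skeleton `Cruxes/SquareFromVoronoiHub/Lines/Sketch.lean` posits, over tree
declarations only, so that the stub files `Theorems/CardyFlipRussoSquareFromVoronoiHub*.lean` and the
assembly can refer to them BY NAME.  Nothing is asserted here beyond `Iff.rfl` bookkeeping.

The crux `CardyFlipRusso.SquareFromVoronoiHub` reads: Cardy's formula for annealed Poisson–Voronoi
percolation (continuum-path event `voronoiCrossing`, every conformal rectangle) implies Cardy's
formula for site percolation at `1/2` on the centred square lattice `G_s = ℤ² ∪ (ℤ² + (½,½))`
(`ℤ²` edges and centre-to-corner edges) in the crude `2δ`-slack discretisation.  The crux spells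
`G_s` and both events out inline; here they get names (`zGs`, `Gs`, `crudeCrossing`,
`siteCrossingProb`, `voronoiCrossingProb`), and `squareFromVoronoiHub_iff` records that the crux is
DEFINITIONALLY "Cardy for `voronoiCrossingProb` → Cardy for `siteCrossingProb`".

The line reads the fair-coloured Poisson nuclei of cell scale `s` OFF THE FIXED LATTICE `G_s(δ)`:
site `y` is black iff its position `δ · zGs y` lies in the black region of the nuclei dilated by `s`
(`blockConfig δ s`, `blockCrossingProb`).  The line's three statements (K0: at `s = δ²` the block
colouring is i.i.d. site percolation up to `o(1)`; K1: at `s = δ^{1/4}` it is a faithful discretisation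
of continuum Poisson–Voronoi percolation at mesh `δ^{1/4}`; C⁺: the two ends of the window have
asymptotically equal crude crossing probabilities) are NOT declared here — they are the registered
stubs of the skeleton and are stated in full by the stub files that prove them.  Sources: the card `Cruxes/SquareFromVoronoiHub/Ideas/
voronoi-blocks-on-fixed-gs.md`; Bollobás–Riordan, *Percolation* (2006), Ch. 8 §8.1–8.3 (random
Voronoi percolation and its discrete approximations); Benjamini–Schramm, Comm. Math. Phys. 197 (1998)
§1 (conformal invariance conjecture for Voronoi percolation).
-/

noncomputable section

open scoped Topology MeasureTheory Pointwise
open Filter Set MeasureTheory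
open Literature.Analysis.FunctionSpaces (PointConfig IsPoissonPointProcess)
open Literature.Probability.RandomPlanarGeometry (ConformalRectangle cardyFunction)
open Literature.Probability.Percolation (SiteConfig sitePercolation siteConnIn half blackRegion
  voronoiCrossing)

namespace Summit.CriticalPhenomena.CardyFormulaZ2.Cruxes.SquareFromVoronoiHub.VoronoiBlocks

/-! ### The centred square lattice `G_s` (verbatim the crux's inline `z`, `G`) -/

/-- Vertex positions of the centred square lattice `G_s`: the left summand `ℤ²` at the integer
points, the right summand (face centres) at `ℤ² + (½,½)` — verbatim the crux's let-bound `z`.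
[folklore] -/
def zGs : (ℤ × ℤ) ⊕ (ℤ × ℤ) → ℂ :=
  Sum.elim (fun x ↦ (x.1 : ℂ) + (x.2 : ℂ) * Complex.I)
    (fun f ↦ ((f.1 : ℂ) + 1 / 2) + ((f.2 : ℂ) + 1 / 2) * Complex.I)

/-- The graph `G_s`: `ℤ²` edges (length `1`) and centre-to-corner edges (length `< 1`, i.e. the four
corners at distance `√2/2` of each face centre) — verbatim the crux's let-bound `G`
(Bollobás–Riordan 2006, Ch. 5 Fig. 5.6: the lattice of site percolation "on `ℤ²` with both
diagonals added in every other face" is NOT this one; `G_s` adds a centre vertex to EVERY face).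
[folklore] -/
def Gs : SimpleGraph ((ℤ × ℤ) ⊕ (ℤ × ℤ)) :=
  SimpleGraph.fromRel (fun a b ↦ a.isLeft = true ∧
    ((b.isLeft = true ∧ dist (zGs a) (zGs b) = 1) ∨ (b.isRight = true ∧ dist (zGs a) (zGs b) < 1)))

/-! ### The two crossing events of the crux -/

/-- The crude crossing event of the conformal rectangle `R` at mesh `δ` for a site configuration
`ω` of `G_s`: an open path with all vertices in `Ω`, from a vertex within `2δ` of the arc `(ab)` to
one within `2δ` of the arc `(cd)` — verbatim the crux's conclusion event. [folklore] -/
def crudeCrossing (R : ConformalRectangle) (δ : ℝ) : Set (SiteConfig ((ℤ × ℤ) ⊕ (ℤ × ℤ))) :=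
  {ω | ∃ u v, Metric.infDist ((δ : ℂ) * zGs u) (R.arc 0) ≤ 2 * δ ∧
      Metric.infDist ((δ : ℂ) * zGs v) (R.arc 2) ≤ 2 * δ ∧
      ω ∈ siteConnIn Gs {y | (δ : ℂ) * zGs y ∈ R.carrier} u v}

/-- The crux's conclusion sequence: the crude crossing probability of `R` at mesh `δ` under site
percolation at `1/2` on `G_s`. [folklore] -/
def siteCrossingProb (R : ConformalRectangle) (δ : ℝ) : ℝ :=
  (sitePercolation ((ℤ × ℤ) ⊕ (ℤ × ℤ)) half).real (crudeCrossing R δ)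

/-- The crux's hypothesis sequence: the annealed Poisson–Voronoi crossing probability of `R` at
mesh `ε` — the `PB ⊗ PW`-probability of the Literature event `voronoiCrossing` (black nuclei `c.1`,
white nuclei `c.2`, read at scale `ε`; black continuum path in `closure Ω` from `(ab)` to `(cd)`;
Bollobás–Riordan 2006, Ch. 8 §8.2). [folklore] -/
def voronoiCrossingProb (PB PW : Measure (PointConfig ℂ)) (R : ConformalRectangle) (ε : ℝ) : ℝ :=
  (PB.prod PW).real {c | voronoiCrossing R.carrier (R.arc 0) (R.arc 2) ε (c.1 : Set ℂ) (c.2 : Set ℂ)}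

/-- SANITY (`Iff.rfl`): the crux BY NAME is "Cardy for `voronoiCrossingProb` (all Poisson pairs, all
conformal rectangles) → Cardy for `siteCrossingProb` (all conformal rectangles)". [folklore] -/
theorem squareFromVoronoiHub_iff :
    Summit.CriticalPhenomena.CardyFormulaZ2.Theses.CardyFlipRusso.SquareFromVoronoiHub ↔
      ((∀ (PB PW : Measure (PointConfig ℂ)),
        IsPoissonPointProcess (volume : Measure ℂ) PB → IsPoissonPointProcess (volume : Measure ℂ) PW →
        ∀ R : ConformalRectangle, R.HasCrossingLimit (voronoiCrossingProb PB PW R) cardyFunction) →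
      ∀ R : ConformalRectangle, R.HasCrossingLimit (siteCrossingProb R) cardyFunction) :=
  Iff.rfl

/-! ### The block colourings of the line -/

/-- The Voronoi-BLOCK colouring of `G_s` at mesh `δ` and cell scale `s`, read off a pair of nucleus
configurations `c = (black, white)`: site `y` is open (black) iff its position `δ · zGs y` lies in
the black region of the nuclei dilated by `s` (at least as close to a black nucleus as to a white
one; Bollobás–Riordan 2006, Ch. 8 §8.1, read on the lattice). [folklore] -/
def blockConfig (δ s : ℝ) (c : PointConfig ℂ × PointConfig ℂ) : SiteConfig ((ℤ × ℤ) ⊕ (ℤ × ℤ)) :=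
  {y | (δ : ℂ) * zGs y ∈ blackRegion ((s : ℂ) • (c.1 : Set ℂ)) ((s : ℂ) • (c.2 : Set ℂ))}

/-- Membership in the block colouring, unfolded to the two `infDist` comparisons. [folklore] -/
theorem mem_blockConfig_iff (δ s : ℝ) (c : PointConfig ℂ × PointConfig ℂ) (y : (ℤ × ℤ) ⊕ (ℤ × ℤ)) :
    y ∈ blockConfig δ s c ↔
      Metric.infDist ((δ : ℂ) * zGs y) ((s : ℂ) • (c.1 : Set ℂ)) ≤
        Metric.infDist ((δ : ℂ) * zGs y) ((s : ℂ) • (c.2 : Set ℂ)) :=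
  Iff.rfl

/-- Crude crossing probability of `R` at mesh `δ` for the block colouring of cell scale `s` under the
pair law `PB ⊗ PW` of the nuclei. [folklore] -/
def blockCrossingProb (PB PW : Measure (PointConfig ℂ)) (R : ConformalRectangle) (δ s : ℝ) : ℝ :=
  (PB.prod PW).real {c | blockConfig δ s c ∈ crudeCrossing R δ}

end Summit.CriticalPhenomena.CardyFormulaZ2.Cruxes.SquareFromVoronoiHub.VoronoiBlocks

end
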